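/-
NEW (pub-hodgecm2, COR-CM cell = stage 2 of the Hodge ladder; binder prover b10, row P7 of `HOME/BINDER-OWNERS.md`, part 2/2).
Not a port: the MODEL CHAIN — the abstract COR-CM chain A1 + A2 (`Assembly.hc_cm_of_periodThmF`, kit #42) INSTANTIATED at
the Picard–CM model universe `Model.universeOf hHD hI hU h₃` (its 28-field `ModelAxioms` record = part 1/2,
`CorCM/Model/ModelAxiomsOfRows.lean`; the geometric facts from the rows' junction theorems), row P7 CLOSED (`Model.chainR`), and
the stage-2 E term CLOSED: `hc_cm_of_PerLFace : HC_CM_of_PerLFace` (arrow A3 in the guarded domination form of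
`CorCM/DictionaryA3.lean` at the landed B03 junction; the Riemann form re-composed from tree theorems as an `example`).
-/
import Summits.HodgeConjecture.CorCM.Assembly.CorCMOfPeriodThmF
import Summits.HodgeConjecture.CorCM.Assembly.DominationOfRiemann
import Summits.HodgeConjecture.CorCM.Model.ModelAxiomsOfRows
import Summits.HodgeConjecture.CorCM.Model.CupRingFacts
import Summits.HodgeConjecture.CorCM.Model.CupExterior
import Summits.HodgeConjecture.CorCM.Model.CupHodge
import Summits.HodgeConjecture.CorCM.Model.FactorActDescends
import Summits.HodgeConjecture.CorCM.Model.WeightDual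
import Summits.HodgeConjecture.CorCM.Model.Gysin
import Summits.HodgeConjecture.CorCM.Model.AlgDualityHolds
import Literature.AlgebraicGeometry.ComplexMultiplication.EndFieldTotallyRealOrCMOfRiemann
import Literature.AlgebraicGeometry.ComplexMultiplication.PrincipalModelOfCMOrder
import HarnessLib

/-!
# COR-CM — the model chain (row P7): `PerLFace ⟹ HC_CM` on the Picard–CM model universe, and the E term

Cell `pub-hodgecm2` (stage 2 of the Hodge ladder), `HOME/CHAIN-MAP.md` arrows A1 + A2 (abstract, `Assembly.hc_cm_of_periodThmF`)
and A3 (dictionary), instantiated at the model of record `U₀ := Model.universeOf hHD hI hU h₃` (`CorCM/Model/Universe.lean`;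
`Model.picardCMUniverse hHD hI h₁ h₃ = universeOf hHD hI (ballQuotientUniformisedDatum_of h₁) h₃` by `rfl`).

* (part 1, `CorCM/Model/ModelAxiomsOfRows.lean`) `Model.modelAxioms_of_rows hHD hI hU h₃ hR h28 : U₀.ModelAxioms` — the 28-field
  record, row by row, over stage 1's cited record `hR : DeligneMilne1982_Thm_6_20_full`, row M22 `Fact_algDuality` entering as `h28`.
* `Model.hc_cm_of_rows` — `U₀.PerLFace → U₀.HC_CM` from the record, the geometric facts N1–N4, F2, F4, F5, F6 (model-2 junction
  theorems, `CorCM/Model/{CupExterior,CupHodge,CupRingFacts,FactorActDescends,WeightDual}.lean`) and fact F7 `Fact_gysin`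
  (as `hF7`), by `Assembly.hc_cm_of_periodThmF`.
* `Model.chainR_of_rows` — ROW P7 in its re-typed hR-form (RULING R7(b)) `∀ hHD hI h₁ h₃, hR → U.PerLFace → U.HC_CM` for the
  model of record, with rows M22, F7 as hypotheses (each universally over the model's parameters, under `hR`, F7 also under the
  record `U₀.ModelAxioms`) — instantiated below at their landed junction theorems.
* `hc_cm_of_PerLFace_of_chainR (dom) (chainR)` — the E-term WRAPPER OF RECORD (RULING R7(b), verbatim): binder B03 in guarded form
  (`dom`, = `Assembly.dom_of_riemann`, LANDED `CorCM/Assembly/DominationOfRiemann.lean`) and `chainR` give `HC_CM_of_PerLFace`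
  through `DictionaryA3.hc_cm_of_model_hc_cm`.
* `hc_cm_of_model_hc_cm_riemann` — arrow A3 in RIEMANN FORM, composed here from the tree theorems
  `Milne1999.forall_cmHodgeHypothesisAt_of_codesHC_of_hSimplePos`, `ComplexMultiplication.hSimplePos_of_prop5`, `prop5_of_riemann`,
  `thm2_cor_of_riemann` (the composite `Milne1999.forall_cmHodgeHypothesisAt_of_codesHC_of_riemann` of
  `Milne1999/TateFromCodesHCOfRiemann.lean` is exactly this term; re-composed so that this file does not import that module — cell
  incident I-1); the E term through it (no domination binder at all) is recorded as `example`s only (RULING E-DEDUP: one constant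
  per closed statement).
* `Model.chainR` — ROW P7 CLOSED: `chainR_of_rows` at the landed junctions of M22 (`Model.universeOf_algDuality`, model-1
  `CorCM/Model/AlgDualityHolds.lean`) and F7 (`Model.universeOf_fact_gysin`, b25 `CorCM/Model/Gysin.lean`).
* `hc_cm_of_PerLFace : HC_CM_of_PerLFace` — THE STAGE-2 E TERM, CLOSED: `hc_cm_of_PerLFace_of_chainR Assembly.dom_of_riemann
  Model.chainR` (road 1); `hc_cm_of_PerL_of_B01` the literal target modulo binder B01 only.

Nothing is asserted: the only hypotheses left anywhere are the displayed TOP data `hHD hI h₁/hU h₃`, stage 1's cited record `hR`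
(inside `HC_CM_of_PerLFace`), the face-form period theorem `PerLFace` (inside `HC_CM_of_PerLFace`), and — for the literal target —
binder B01 `PerLFace_of_PerL`.
-/

noncomputable section

namespace Summit.HodgeConjecture.CorCM

open Literature.NumberTheory.Automorphic.PicardCM
open Literature.AlgebraicGeometry.HodgeTheory
open Literature.AlgebraicGeometry.ComplexMultiplication (thm2_cor_of_riemann hSimplePos_of_prop5 prop5_of_riemann)
open Literature.AlgebraicGeometry.Milne1999 (forall_cmHodgeHypothesisAt_of_codesHC_of_hSimplePos)

namespace Model

/-! ## The chain on the model: `PerLFace ⟹ HC_CM` for `U₀`, rows M22 and F7 as hypotheses -/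

/-- **The model chain** (arrows A1 + A2 of `HOME/CHAIN-MAP.md` on the model universe): the face-form period theorem
`U₀.PerLFace` (`= U₀.PeriodThmF`) implies `U₀.HC_CM` — by `Assembly.hc_cm_of_periodThmF` fed with `modelAxioms_of_rows`, the
geometric facts N1 `cupExterior` (model-2 `Model/CupExterior.lean`), N2 `cup_hodge` (`Model/CupHodge.lean`), N3 `pull_H0`, N4
`hodge_F0`, F4 `cupAlg`, F5 `cupAssoc` (`Model/CupRingFacts.lean`), F2 `factorActDescends` (`Model/FactorActDescends.lean`, from the
record), F6 `weightDual` (`Model/WeightDual.lean`, from the record), and — BY NAME, still open — M22 `Fact_algDuality` (`h28`),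
F7 `Fact_gysin` (`hF7`). -/
theorem hc_cm_of_rows (hHD : exists_isReal_hodgeModel) (hI : hodgePQ_independent_of_hodgeModel)
    (hU : BallQuotientUniformisedDatum) (h₃ : CMAbelianVarietyRealised) (hR : DeligneMilne1982_Thm_6_20_full)
    (h28 : (universeOf hHD hI hU h₃).Fact_algDuality) (hF7 : (universeOf hHD hI hU h₃).Fact_gysin)
    (hP : (universeOf hHD hI hU h₃).PerLFace) : (universeOf hHD hI hU h₃).HC_CM :=
  Assembly.hc_cm_of_periodThmF (universeOf hHD hI hU h₃) (modelAxioms_of_rows hHD hI hU h₃ hR h28) hP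
    (universeOf_fact_cupExterior hHD hI hU h₃) (universeOf_fact_cup_hodge hHD hI hU h₃)
    (universeOf_fact_pull_H0 hHD hI hU h₃) (universeOf_fact_hodge_F0 hHD hI hU h₃)
    (universeOf_fact_factorActDescends hHD hI hU h₃ (modelAxioms_of_rows hHD hI hU h₃ hR h28))
    (universeOf_fact_cupAlg hHD hI hU h₃) (universeOf_fact_cupAssoc hHD hI hU h₃)
    (universeOf_fact_weightDual hHD hI hU h₃ (modelAxioms_of_rows hHD hI hU h₃ hR h28)) hF7

end Model

/-! ## Row P7 in its re-typed hR-form `chainR` (RULING R7(b)) with M22/F7 as hypotheses, and the E-term wrapper -/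

/-- **Row P7 (`chainR`, hR-form, RULING R7(b)) modulo rows M22 and F7**: for every instance of the model universe of record
`Model.picardCMUniverse hHD hI h₁ h₃`, Deligne–Milne 1982 Thm 6.20 and the face-form period theorem imply `U.HC_CM` — given,
BY NAME and so that any junction shape instantiates them, row M22 `Fact_algDuality` (`h28`, under `hR`) and fact F7 `Fact_gysin`
(`hF7`, under `hR` and the record).  The closed `chainR` (exactly the row type
`∀ hHD hI h₁ h₃, DeligneMilne1982_Thm_6_20_full → U.PerLFace → U.HC_CM`) is this theorem at the two junction theorems. -/
theorem Model.chainR_of_rows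
    (h28 : ∀ (hHD : exists_isReal_hodgeModel) (hI : hodgePQ_independent_of_hodgeModel)
      (hU : BallQuotientUniformisedDatum) (h₃ : CMAbelianVarietyRealised),
      DeligneMilne1982_Thm_6_20_full → (Model.universeOf hHD hI hU h₃).Fact_algDuality)
    (hF7 : ∀ (hHD : exists_isReal_hodgeModel) (hI : hodgePQ_independent_of_hodgeModel)
      (hU : BallQuotientUniformisedDatum) (h₃ : CMAbelianVarietyRealised),
      DeligneMilne1982_Thm_6_20_full → (Model.universeOf hHD hI hU h₃).ModelAxioms → (Model.universeOf hHD hI hU h₃).Fact_gysin) :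
    ∀ (hHD : exists_isReal_hodgeModel) (hI : hodgePQ_independent_of_hodgeModel)
      (h₁ : BallQuotientUniformised) (h₃ : CMAbelianVarietyRealised),
      DeligneMilne1982_Thm_6_20_full →
        (Model.picardCMUniverse hHD hI h₁ h₃).PerLFace → (Model.picardCMUniverse hHD hI h₁ h₃).HC_CM :=
  fun hHD hI h₁ h₃ hR hP =>
    Model.hc_cm_of_rows hHD hI (ballQuotientUniformisedDatum_of h₁) h₃ hR (h28 hHD hI _ h₃ hR)
      (hF7 hHD hI _ h₃ hR (Model.modelAxioms_of_rows hHD hI _ h₃ hR (h28 hHD hI _ h₃ hR))) hP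

/-- **The E-term wrapper of record (RULING R7(b), verbatim)**: guarded domination from Riemann's theorem (`dom`, binder B03 —
in the tree `Assembly.dom_of_riemann`, `CorCM/Assembly/DominationOfRiemann.lean`) and the hR-form model chain `chainR` (row P7)
give the working stage-2 target `HC_CM_of_PerLFace`, through arrow A3 `DictionaryA3.hc_cm_of_model_hc_cm`. -/
theorem hc_cm_of_PerLFace_of_chainR
    (dom : ∀ (h₁ : BallQuotientUniformised) (h₃ : CMAbelianVarietyRealised),
      DeligneMilne1982_Thm_6_20_full → CMDominatedByCodesPos (ballQuotientUniformisedDatum_of h₁) h₃)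
    (chainR : ∀ (hHD : exists_isReal_hodgeModel) (hI : hodgePQ_independent_of_hodgeModel)
      (h₁ : BallQuotientUniformised) (h₃ : CMAbelianVarietyRealised),
      DeligneMilne1982_Thm_6_20_full →
        (Model.picardCMUniverse hHD hI h₁ h₃).PerLFace → (Model.picardCMUniverse hHD hI h₁ h₃).HC_CM) :
    HC_CM_of_PerLFace :=
  fun hHD hI h₁ h₃ hP hR => hc_cm_of_model_hc_cm hHD hI h₁ h₃ (dom h₁ h₃ hR) (chainR hHD hI h₁ h₃ hR hP)

/-- **Arrow A3, Riemann form**: `U.HC_CM` for the model universe implies `HC_CM`, over stage 1's cited record `hR` — the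
junction `picardCMUniverse_hc_cm_iff_codesHC` (`Iff.rfl`) followed by Milne's (I) ⟹ (H)
(`Milne1999.forall_cmHodgeHypothesisAt_of_codesHC_of_hSimplePos`) with its two inputs discharged from Riemann's theorem:
Shimura 1998 §6.1 Cor. of Thm 2 (`thm2_cor_of_riemann hR`) and the guarded binder `hSimplePos`
(`hSimplePos_of_prop5 (prop5_of_riemann hR)`, Shimura §5.1 Prop. 5 + §7.1 Prop. 7).  This is the body of the tree's
`Milne1999.forall_cmHodgeHypothesisAt_of_codesHC_of_riemann`, re-composed from its parts (no B03 binder). -/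
theorem hc_cm_of_model_hc_cm_riemann (hHD : exists_isReal_hodgeModel) (hI : hodgePQ_independent_of_hodgeModel)
    (h₁ : BallQuotientUniformised) (h₃ : CMAbelianVarietyRealised) (hR : DeligneMilne1982_Thm_6_20_full)
    (h : (Model.picardCMUniverse hHD hI h₁ h₃).HC_CM) : HC_CM :=
  hc_cm_iff_forall_cmHodgeHypothesisAt.2
    (forall_cmHodgeHypothesisAt_of_codesHC_of_hSimplePos ((picardCMUniverse_hc_cm_iff_codesHC hHD hI h₁ h₃).1 h)
      (thm2_cor_of_riemann hR) (hSimplePos_of_prop5 (prop5_of_riemann hR)))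

/-! ## The closed row P7 and the closed E term (rows M22 and F7 landed 2026-08-20: model-1 p236155, b25 p236748) -/

/-- **Row P7, CLOSED (`chainR`, exactly the re-typed row type of RULING R7(b))**: for every instance of the Picard–CM model
universe of record, Deligne–Milne 1982 Thm 6.20 (`hR`, binder B02) and the face-form period theorem imply `U.HC_CM` — row M22
from `Model.universeOf_algDuality` (`CorCM/Model/AlgDualityHolds.lean`) and fact F7 from `Model.universeOf_fact_gysin`
(`CorCM/Model/Gysin.lean`). -/
theorem Model.chainR :
    ∀ (hHD : exists_isReal_hodgeModel) (hI : hodgePQ_independent_of_hodgeModel)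
      (h₁ : BallQuotientUniformised) (h₃ : CMAbelianVarietyRealised),
      DeligneMilne1982_Thm_6_20_full →
        (Model.picardCMUniverse hHD hI h₁ h₃).PerLFace → (Model.picardCMUniverse hHD hI h₁ h₃).HC_CM :=
  Model.chainR_of_rows (fun hHD hI hU h₃ _ => Model.universeOf_algDuality hHD hI hU h₃)
    (fun hHD hI hU h₃ _ _ => Model.universeOf_fact_gysin hHD hI hU h₃)

/-- **THE STAGE-2 E TERM, CLOSED** (working target of `CorCM/Interfaces.lean`): on the Picard–CM model universe of record, the
face-form period theorem `PerLFace` together with Deligne–Milne 1982 Thm 6.20 implies the Hodge conjecture for every complex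
abelian variety of CM type — `HC_CM = Summit.HodgeConjecture.HodgeConjecture.Theses.RankFourFaces.CMAbelianHodge`, BY NAME.
The wrapper of record at the landed B03 junction `Assembly.dom_of_riemann` and the closed row P7 `Model.chainR`. -/
theorem hc_cm_of_PerLFace : HC_CM_of_PerLFace :=
  hc_cm_of_PerLFace_of_chainR Assembly.dom_of_riemann Model.chainR

/- The same E term through arrow A3 in Riemann form (no domination binder; same axioms) — an `example`, not a second
constant of type `HC_CM_of_PerLFace` (RULING E-DEDUP). -/
example : HC_CM_of_PerLFace :=
  fun hHD hI h₁ h₃ hP hR => hc_cm_of_model_hc_cm_riemann hHD hI h₁ h₃ hR (Model.chainR hHD hI h₁ h₃ hR hP)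

/-- **The literal stage-2 target modulo binder B01 only**: `PerLFace_of_PerL` (gap G-T) gives `HC_CM_of_PerL`. -/
theorem hc_cm_of_PerL_of_B01 (hB01 : PerLFace_of_PerL) : HC_CM_of_PerL :=
  hc_cm_of_PerL_of_face hc_cm_of_PerLFace hB01

end Summit.HodgeConjecture.CorCM

end
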